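import Summits.QuantumFields.YangMills.Theorems.AlphaInputsT3ACv3EMLTwoFieldIterUniform
import Summits.QuantumFields.YangMills.Theorems.AlphaInputsT3ACv3LinearLiftTorus
import HarnessLib

/-!
# `AlphaInputsT3ACv3FLContractionCore` — STRATEGY B for 2′, non-abelian (FL) (memo v2.1 row R6, CORE): **ONE CONTRACTION STEP FOR THE `hLift` BINDER, IN A STENCIL GAUGE, WITH THE
# LIFT ABSTRACTED** — if the update `U ↦ U′` has `k`-fold linear response `Q^{(k)}(U′ − U) = (V − Ū^{(k)}) − dψ` up to `τ` (what the matrix lift `S1M` of w3 supplies, with its block-constant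
# pure gauge `ψ`), then after the block-constant gauge rotation `φ = e^{−ψ}` the NEW defect is
# `‖V(c) − \overline{(U′)^{φ̂}}^{(k)}(c)‖ ≤ (τ + e_k) + 2p·ε_V + 2p₂ + (quadratic)`, `e_k = 5200·L·(d+2)²·m_k(ρ)(m_k(ρ)+m_k(δ))` the `k`-UNIFORM derivative-row error of
# `…v3EMLTwoFieldIterUniform` — lane `pub-balaban3d` ∕ cell `ym3-torus`, seat `ym-ust-19936-w1` (g0)

WHY (HOME `ym-ust-19936-w1/NONABELIAN-FL-NEWTON-w1-g0.md` §2 R6, §6).  The contraction for `hLift` updates the fine field by the exponentiated matrix spread of the current defect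
`Δ = V − Ū^{(k)}` and then removes the spread's block-constant pure gauge by an honest gauge transformation (`Averaging.iter` is EXACTLY covariant, `T4Continuum.iter_gaugeAct`; for a
block-constant `φ̂ = φ ∘ iterBlockOf k` the coarse transformation is `φ` itself, §1).  This file isolates the step's ALGEBRA + ANALYSIS from the construction of the update: the update enters
only through (i) its sup distance `ρ` to `U` (for the derivative row) and (ii) the abstract exactness `hT`.  §2 is the matrix inequality behind «the pure gauge cancels the `dψ` of the
linear response to first order»: `‖V − g₁(V − (ψ₂−ψ₁) + R)g₂*‖ ≤ ‖R‖ + 2pε_V + 2p₂ + O(p(p+‖R‖))` for `g₁ ≈ 1 − ψ₁`, `g₂* ≈ 1 + ψ₂`.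
WHAT IS HERE (no definition): §1 `transfUp_eq_toFine`, `transfUp_blockConst`, `iter_gaugeAct_blockConst`, `dist1_plaqHol_gaugeAct` (plaquettes are gauge invariant in size); §2
`norm_sub_conj_update_le` (matrices); §3 ★★ `norm_defect_after_step_le` (the title) and `dist1_plaqHol_after_step` (the rotated update has the plaquettes of `U′`).
HONEST FRAMING.  One step, stencil gauge, lift abstracted (binder `hT`); the glued start (R9′), the matrix lift (R4, w3) and the limit (R7) are NOT here; (FL)∕`hLift` NOT proved; count-neutral
helper toward R3 2′ (items 19936∕19935); registry untouched; nothing about d = 4, the continuum, or a mass gap; YM₃ on T³ is rung R3, not Clay.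

References: T. Bałaban, Commun. Math. Phys. 98 (1985) 17–51 [Balaban1985Averaging] ((11)–(13) p.19, Prop. 4 (134)–(135) p.38, Prop. 5 p.42); CMP 102 (1985) 277–309
[Balaban1985Variational] ((15)–(17) p.280); CMP 109 (1987) 249–301 [Balaban1987RG1] ((0.4), (0.11) p.253).
-/

set_option autoImplicit false

noncomputable section

namespace Summit.QuantumFields.YangMills.Theorems.FLContraction

open Finset
open scoped Matrix.Norms.L2Operator
open Literature.MathematicalPhysics.QuantumFieldTheory.Balaban1983to89
open T4Continuum AveragingRT BlockAveraging ExpMeanLog BlockAveragingEMLLinearised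
open Literature.MathematicalPhysics.QuantumFieldTheory.Balaban1983to89.B5Eq118OneStroke (iterBlockOf)
open Literature.MathematicalPhysics.QuantumFieldTheory.Balaban1983to89.B10Eq38TorusDomains (toFine toFine_zero toFine_succ)
open Summit.QuantumFields.YangMills.Theorems.LinearLiftSpread (iterBlockOf_toFine)
open Summit.QuantumFields.YangMills.Theorems.EMLTwoField (norm_iter_sub_iter_sub_iterLin_le_uniform)

/-! ## §1 Block-constant gauge transformations through the averages -/

section Gauge

variable {P : Params} {G : Type*} [GaugeGroup G]

omit [GaugeGroup G] in
/-- `transfUp u k y = u (toFine k y)`: the restricted transformation reads `u` at the representative fine site. [cite: Balaban1985Averaging, (11) p.19] -/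
theorem transfUp_eq_toFine (u : GaugeTransf P 0 G) : ∀ (k : ℕ) (y : Site P k), transfUp u k y = u (toFine k y)
  | 0, _ => rfl
  | k + 1, y => by
    show transfUp u k (emb y) = u (toFine (k + 1) y)
    rw [transfUp_eq_toFine u k, toFine_succ]

omit [GaugeGroup G] in
/-- **THE RESTRICTION OF A BLOCK-CONSTANT TRANSFORMATION IS THE COARSE TRANSFORMATION ITSELF** (`k ≤ m + K`). [cite: Balaban1985Averaging, (11)–(13) p.19] -/
theorem transfUp_blockConst {k : ℕ} (hk : k ≤ P.m + P.K) (φ : GaugeTransf P k G) :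
    transfUp (fun x : Site P 0 => φ (iterBlockOf k x)) k = φ := by
  funext y
  rw [transfUp_eq_toFine]
  show φ (iterBlockOf k (toFine k y)) = φ y
  rw [iterBlockOf_toFine k hk y]

/-- **EXACT COVARIANCE UNDER A BLOCK-CONSTANT GAUGE TRANSFORMATION**: `Ū^{(k)}(U^{φ∘iterBlockOf}) = (Ū^{(k)}U)^{φ}` for every family of covariant one-step averagings.
[cite: Balaban1985Averaging, (11)–(13) p.19] -/
theorem iter_gaugeAct_blockConst (av : ∀ j, Averaging P j G) {k : ℕ} (hk : k ≤ P.m + P.K) (φ : GaugeTransf P k G) (U : GaugeField P 0 G) :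
    Averaging.iter av k (GaugeField.gaugeAct (fun x : Site P 0 => φ (iterBlockOf k x)) U) = GaugeField.gaugeAct φ (Averaging.iter av k U) := by
  rw [iter_gaugeAct av _ k hk U, transfUp_blockConst hk φ]

/-- Plaquette sizes are gauge invariant: `dist1 (U^u(∂q)) = dist1 (U(∂q))` (`U^u(∂q) = u(q₋)U(∂q)u(q₋)⁻¹`). [cite: Balaban1985Averaging, (9)+(12) p.19] -/
theorem dist1_plaqHol_gaugeAct {j : ℕ} (u : GaugeTransf P j G) (U : GaugeField P j G) (q : Plaq P j) :
    GaugeGroup.dist1 (GaugeField.plaqHol (GaugeField.gaugeAct u U) q) = GaugeGroup.dist1 (GaugeField.plaqHol U q) := by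
  have hconj : GaugeField.plaqHol (GaugeField.gaugeAct u U) q = u q.src * GaugeField.plaqHol U q * (u q.src)⁻¹ := by
    simp only [GaugeField.plaqHol, GaugeField.gaugeAct, PBond.tgt, Site.shift_comm q.src q.ν q.μ]
    group
  rw [hconj, GaugeGroup.dist1_conj]

end Gauge

/-! ## §2 The matrix inequality of the step -/

section Matrices

variable {n : Type*} [Fintype n] [DecidableEq n]

/-- **THE PURE GAUGE CANCELS THE COBOUNDARY TO FIRST ORDER**: for `‖V‖ ≤ 1`, `‖V − 1‖ ≤ ε_V`, `‖ψ₁‖, ‖ψ₂‖ ≤ p`, `‖g₁ − (1 − ψ₁)‖ ≤ p₂`, `‖g₂s − (1 + ψ₂)‖ ≤ p₂`, `‖R‖ ≤ r`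
(`0 ≤ p, p₂, r, ε_V`):  `‖V − g₁·(V − (ψ₂ − ψ₁) + R)·g₂s‖ ≤ r + 2pε_V + 2p₂ + (p+p₂)·(2(2p+r) + (p+p₂)(1 + 2p + r))`.
[cite: Balaban1985Variational, (16)–(17) p.280 (bookkeeping)] -/
theorem norm_sub_conj_update_le (V g₁ g₂s ψ₁ ψ₂ R : Matrix n n ℂ) {εV p p₂ r : ℝ} (hεV : 0 ≤ εV) (hp : 0 ≤ p) (hp₂ : 0 ≤ p₂) (hr : 0 ≤ r)
    (hV : ‖V‖ ≤ 1) (hV1 : ‖V - 1‖ ≤ εV) (hψ₁ : ‖ψ₁‖ ≤ p) (hψ₂ : ‖ψ₂‖ ≤ p)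
    (hg₁ : ‖g₁ - (1 - ψ₁)‖ ≤ p₂) (hg₂ : ‖g₂s - (1 + ψ₂)‖ ≤ p₂) (hR : ‖R‖ ≤ r) :
    ‖V - g₁ * (V - (ψ₂ - ψ₁) + R) * g₂s‖ ≤ r + 2 * p * εV + 2 * p₂ + (p + p₂) * (2 * (2 * p + r) + (p + p₂) * (1 + 2 * p + r)) := by
  set A : Matrix n n ℂ := g₁ - 1 with hA
  set C : Matrix n n ℂ := g₂s - 1 with hC
  set B : Matrix n n ℂ := -(ψ₂ - ψ₁) + R with hB
  set r₁ : Matrix n n ℂ := g₁ - (1 - ψ₁) with hr₁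
  set r₂ : Matrix n n ℂ := g₂s - (1 + ψ₂) with hr₂
  have hA' : A = -ψ₁ + r₁ := by rw [hA, hr₁]; abel
  have hC' : C = ψ₂ + r₂ := by rw [hC, hr₂]; abel
  have hAn : ‖A‖ ≤ p + p₂ := by rw [hA']; exact (norm_add_le _ _).trans (by rw [norm_neg]; exact add_le_add hψ₁ hg₁)
  have hCn : ‖C‖ ≤ p + p₂ := by rw [hC']; exact (norm_add_le _ _).trans (add_le_add hψ₂ hg₂)
  have hBn : ‖B‖ ≤ 2 * p + r := by
    rw [hB]
    calc ‖-(ψ₂ - ψ₁) + R‖ ≤ ‖-(ψ₂ - ψ₁)‖ + ‖R‖ := norm_add_le _ _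
      _ ≤ (‖ψ₂‖ + ‖ψ₁‖) + ‖R‖ := add_le_add (by rw [norm_neg]; exact norm_sub_le _ _) le_rfl
      _ ≤ 2 * p + r := by linarith
  -- the expansion `(1+A)(V+B)(1+C) − V = (B + AV + VC) + (AB + BC + AVC + ABC)`
  have e1 : g₁ * (V - (ψ₂ - ψ₁) + R) * g₂s = (1 + A) * (V + B) * (1 + C) := by rw [hA, hC, hB]; noncomm_ring
  have e2 : V - (1 + A) * (V + B) * (1 + C) = -((B + A * V + V * C) + (A * B + B * C + A * V * C + A * B * C)) := by noncomm_ring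
  -- the first-order piece: `B + AV + VC = R + (−ψ₁(V−1) + (V−1)ψ₂) + r₁V + Vr₂`
  have e3 : B + A * V + V * C = R + (-(ψ₁ * (V - 1)) + (V - 1) * ψ₂) + (r₁ * V + V * r₂) := by rw [hB, hA', hC']; noncomm_ring
  have hfirst : ‖B + A * V + V * C‖ ≤ r + 2 * p * εV + 2 * p₂ := by
    rw [e3]
    have h1 : ‖-(ψ₁ * (V - 1)) + (V - 1) * ψ₂‖ ≤ 2 * p * εV := by
      calc _ ≤ ‖-(ψ₁ * (V - 1))‖ + ‖(V - 1) * ψ₂‖ := norm_add_le _ _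
        _ ≤ ‖ψ₁‖ * ‖V - 1‖ + ‖V - 1‖ * ‖ψ₂‖ := add_le_add (by rw [norm_neg]; exact norm_mul_le _ _) (norm_mul_le _ _)
        _ ≤ p * εV + εV * p := add_le_add (mul_le_mul hψ₁ hV1 (norm_nonneg _) hp) (mul_le_mul hV1 hψ₂ (norm_nonneg _) hεV)
        _ = 2 * p * εV := by ring
    have h2 : ‖r₁ * V + V * r₂‖ ≤ 2 * p₂ := by
      calc _ ≤ ‖r₁‖ * ‖V‖ + ‖V‖ * ‖r₂‖ := (norm_add_le _ _).trans (add_le_add (norm_mul_le _ _) (norm_mul_le _ _))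
        _ ≤ p₂ * 1 + 1 * p₂ := add_le_add (mul_le_mul hg₁ hV (norm_nonneg _) hp₂) (mul_le_mul hV hg₂ (norm_nonneg _) zero_le_one)
        _ = 2 * p₂ := by ring
    calc _ ≤ ‖R‖ + ‖-(ψ₁ * (V - 1)) + (V - 1) * ψ₂‖ + ‖r₁ * V + V * r₂‖ := (norm_add_le _ _).trans (add_le_add (norm_add_le _ _) le_rfl)
      _ ≤ r + 2 * p * εV + 2 * p₂ := by linarith
  -- the higher-order piece
  have hp' : 0 ≤ p + p₂ := add_nonneg hp hp₂
  have hB0 : 0 ≤ 2 * p + r := by positivity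
  have hsecond : ‖A * B + B * C + A * V * C + A * B * C‖ ≤ (p + p₂) * (2 * (2 * p + r) + (p + p₂) * (1 + 2 * p + r)) := by
    have t1 : ‖A * B‖ ≤ (p + p₂) * (2 * p + r) := (norm_mul_le _ _).trans (mul_le_mul hAn hBn (norm_nonneg _) hp')
    have t2 : ‖B * C‖ ≤ (2 * p + r) * (p + p₂) := (norm_mul_le _ _).trans (mul_le_mul hBn hCn (norm_nonneg _) hB0)
    have t3 : ‖A * V * C‖ ≤ (p + p₂) * 1 * (p + p₂) :=
      (norm_mul_le _ _).trans (mul_le_mul ((norm_mul_le _ _).trans (mul_le_mul hAn hV (norm_nonneg _) hp')) hCn (norm_nonneg _) (by positivity))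
    have t4 : ‖A * B * C‖ ≤ (p + p₂) * (2 * p + r) * (p + p₂) :=
      (norm_mul_le _ _).trans (mul_le_mul ((norm_mul_le _ _).trans (mul_le_mul hAn hBn (norm_nonneg _) hp')) hCn (norm_nonneg _) (by positivity))
    calc _ ≤ ‖A * B‖ + ‖B * C‖ + ‖A * V * C‖ + ‖A * B * C‖ :=
          (norm_add_le _ _).trans (add_le_add ((norm_add_le _ _).trans (add_le_add (norm_add_le _ _) le_rfl)) le_rfl)
      _ ≤ (p + p₂) * (2 * p + r) + (2 * p + r) * (p + p₂) + (p + p₂) * 1 * (p + p₂) + (p + p₂) * (2 * p + r) * (p + p₂) := by linarith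
      _ = (p + p₂) * (2 * (2 * p + r) + (p + p₂) * (1 + 2 * p + r)) := by ring
  rw [e1, e2, norm_neg]
  exact (norm_add_le _ _).trans (by linarith)

end Matrices

/-! ## §3 One contraction step -/

section Step

variable {P : Params} {n : Type*} [Fintype n] [DecidableEq n] [Nonempty n]

/-- **THE ROTATED UPDATE HAS THE PLAQUETTES OF `U′`** (block-constant or not, any gauge transformation). [cite: Balaban1985Averaging, (9)+(12) p.19] -/
theorem dist1_plaqHol_after_step {k : ℕ} (φ : GaugeTransf P k (Matrix.specialUnitaryGroup n ℂ)) (U' : GaugeField P 0 (Matrix.specialUnitaryGroup n ℂ)) (q : Plaq P 0) :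
    GaugeGroup.dist1 (GaugeField.plaqHol (GaugeField.gaugeAct (fun x : Site P 0 => φ (iterBlockOf k x)) U') q) = GaugeGroup.dist1 (GaugeField.plaqHol U' q) :=
  dist1_plaqHol_gaugeAct _ U' q

/-- **★★ ONE CONTRACTION STEP (stencil gauge, lift abstracted).**  `Q` = the characterised composites of `linAvg`; `d + 2 ≤ L`, `k ≤ m + K`; fine fields `U` (`δ`-close to `1`) and `U′`
(`ρ`-close to `U`) under the smallness of `…v3EMLTwoFieldIterUniform`; datum `V` with `‖V(c) − 1‖ ≤ ε_V` on a set `S` of level-`k` bonds; a coarse `ψ` with `‖ψ(y)‖ ≤ p` and a coarse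
`SU(N)`-transformation `φ` with `‖φ(y) − (1 − ψ(y))‖ ≤ p₂`, `‖φ(y)* − (1 + ψ(y))‖ ≤ p₂`; ABSTRACT EXACTNESS `hT`: `‖Q^{(k)}(U′ − U)(c) − ((V(c) − Ū^{(k)}(c)) − (ψ(c₊) − ψ(c₋)))‖ ≤ τ` on `S`.
THEN on `S`, with `φ̂ = φ ∘ iterBlockOf k` and `e_k = 5200·L·(d+2)²·m_k(ρ)(m_k(ρ)+m_k(δ))`:
`‖V(c) − \overline{(U′)^{φ̂}}^{(k)}(c)‖ ≤ (τ + e_k) + 2p·ε_V + 2p₂ + (p+p₂)(2(2p + τ + e_k) + (p+p₂)(1 + 2p + τ + e_k))`.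
With `p = O(|Δ|)`, `p₂ = O(|Δ|²)`, `τ, e_k = O(|Δ|(ε + |Δ|))` this is `|Δ_new| ≤ θ|Δ|`, `θ = poly·(ε + ε_V + |Δ|)` — a contraction, with NO `k` in the constant.
[cite: Balaban1985Averaging, Prop. 4 (134)–(135) p.38, (11)–(13) p.19; Balaban1985Variational, (15)–(17) p.280] -/
theorem norm_defect_after_step_le
    (Q : (i : ℕ) → (PBond P 0 → Matrix n n ℂ) → PBond P i → Matrix n n ℂ)
    (hQ0 : ∀ Y, Q 0 Y = Y) (hQs : ∀ (i : ℕ) (Y : PBond P 0 → Matrix n n ℂ) (c : PBond P (i + 1)), Q (i + 1) Y c = linAvg (Q i Y) c)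
    (hL : P.d + 2 ≤ P.L) {k : ℕ} (hk : k ≤ P.m + P.K)
    (U U' : GaugeField P 0 (Matrix.specialUnitaryGroup n ℂ)) {δ ρ : ℝ} (hδ : 0 ≤ δ) (hρ0 : 0 ≤ ρ)
    (hU : ∀ b, ‖((U b : Matrix.specialUnitaryGroup n ℂ) : Matrix n n ℂ) - 1‖ ≤ δ)
    (hρ : ∀ b, ‖((U' b : Matrix.specialUnitaryGroup n ℂ) : Matrix n n ℂ) - ((U b : Matrix.specialUnitaryGroup n ℂ) : Matrix n n ℂ)‖ ≤ ρ)
    (hmδ : 324 * (P.L : ℝ) * ((P.d : ℝ) + 2) ^ 2 * (2 * (Fintype.card n : ℝ) ^ 2 * (((P.d : ℝ) + 1) * (P.L : ℝ) ^ k * δ)) ≤ 1)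
    (hm : 5200 * (P.L : ℝ) * ((P.d : ℝ) + 2) ^ 2 *
      (2 * (Fintype.card n : ℝ) ^ 2 * (((P.d : ℝ) + 1) * (P.L : ℝ) ^ k * ρ) + 2 * (Fintype.card n : ℝ) ^ 2 * (((P.d : ℝ) + 1) * (P.L : ℝ) ^ k * δ)) ≤ 1)
    (hN : 4 * (((P.d + 2) * P.L : ℕ) : ℝ) *
      (2 * (Fintype.card n : ℝ) ^ 2 * (((P.d : ℝ) + 1) * (P.L : ℝ) ^ k * ρ) + 2 * (Fintype.card n : ℝ) ^ 2 * (((P.d : ℝ) + 1) * (P.L : ℝ) ^ k * δ)) < deltaSU n)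
    (V : GaugeField P k (Matrix.specialUnitaryGroup n ℂ)) (S : Set (PBond P k)) {εV : ℝ} (hεV : 0 ≤ εV)
    (hV1 : ∀ c ∈ S, ‖((V c : Matrix.specialUnitaryGroup n ℂ) : Matrix n n ℂ) - 1‖ ≤ εV)
    (ψ : Site P k → Matrix n n ℂ) {p : ℝ} (hp : 0 ≤ p) (hψ : ∀ y, ‖ψ y‖ ≤ p)
    (φ : GaugeTransf P k (Matrix.specialUnitaryGroup n ℂ)) {p₂ : ℝ} (hp₂ : 0 ≤ p₂)
    (hφ : ∀ y, ‖((φ y : Matrix.specialUnitaryGroup n ℂ) : Matrix n n ℂ) - (1 - ψ y)‖ ≤ p₂)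
    (hφs : ∀ y, ‖star ((φ y : Matrix.specialUnitaryGroup n ℂ) : Matrix n n ℂ) - (1 + ψ y)‖ ≤ p₂)
    {τ : ℝ} (hτ : 0 ≤ τ)
    (hT : ∀ c ∈ S, ‖Q k (fun b => ((U' b : Matrix.specialUnitaryGroup n ℂ) : Matrix n n ℂ) - ((U b : Matrix.specialUnitaryGroup n ℂ) : Matrix n n ℂ)) c -
        ((((V c : Matrix.specialUnitaryGroup n ℂ) : Matrix n n ℂ) -
            ((Averaging.iter (fun i => blockAvg (P := P) (j := i) (expMeanLogSU (n := n))) k U c : Matrix.specialUnitaryGroup n ℂ) : Matrix n n ℂ)) -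
          (ψ c.tgt - ψ c.src))‖ ≤ τ) :
    ∀ c ∈ S, ‖((V c : Matrix.specialUnitaryGroup n ℂ) : Matrix n n ℂ) -
        ((Averaging.iter (fun i => blockAvg (P := P) (j := i) (expMeanLogSU (n := n))) k
            (GaugeField.gaugeAct (fun x : Site P 0 => φ (iterBlockOf k x)) U') c : Matrix.specialUnitaryGroup n ℂ) : Matrix n n ℂ)‖ ≤
      (τ + 5200 * (P.L : ℝ) * ((P.d : ℝ) + 2) ^ 2 * ((2 * (Fintype.card n : ℝ) ^ 2 * (((P.d : ℝ) + 1) * (P.L : ℝ) ^ k * ρ)) *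
          ((2 * (Fintype.card n : ℝ) ^ 2 * (((P.d : ℝ) + 1) * (P.L : ℝ) ^ k * ρ)) + (2 * (Fintype.card n : ℝ) ^ 2 * (((P.d : ℝ) + 1) * (P.L : ℝ) ^ k * δ))))) +
        2 * p * εV + 2 * p₂ +
        (p + p₂) * (2 * (2 * p + (τ + 5200 * (P.L : ℝ) * ((P.d : ℝ) + 2) ^ 2 * ((2 * (Fintype.card n : ℝ) ^ 2 * (((P.d : ℝ) + 1) * (P.L : ℝ) ^ k * ρ)) *
          ((2 * (Fintype.card n : ℝ) ^ 2 * (((P.d : ℝ) + 1) * (P.L : ℝ) ^ k * ρ)) + (2 * (Fintype.card n : ℝ) ^ 2 * (((P.d : ℝ) + 1) * (P.L : ℝ) ^ k * δ)))))) +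
          (p + p₂) * (1 + 2 * p + (τ + 5200 * (P.L : ℝ) * ((P.d : ℝ) + 2) ^ 2 * ((2 * (Fintype.card n : ℝ) ^ 2 * (((P.d : ℝ) + 1) * (P.L : ℝ) ^ k * ρ)) *
          ((2 * (Fintype.card n : ℝ) ^ 2 * (((P.d : ℝ) + 1) * (P.L : ℝ) ^ k * ρ)) + (2 * (Fintype.card n : ℝ) ^ 2 * (((P.d : ℝ) + 1) * (P.L : ℝ) ^ k * δ))))))) := by
  set ek : ℝ := 5200 * (P.L : ℝ) * ((P.d : ℝ) + 2) ^ 2 * ((2 * (Fintype.card n : ℝ) ^ 2 * (((P.d : ℝ) + 1) * (P.L : ℝ) ^ k * ρ)) *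
      ((2 * (Fintype.card n : ℝ) ^ 2 * (((P.d : ℝ) + 1) * (P.L : ℝ) ^ k * ρ)) + (2 * (Fintype.card n : ℝ) ^ 2 * (((P.d : ℝ) + 1) * (P.L : ℝ) ^ k * δ)))) with hek
  have hek0 : 0 ≤ ek := by rw [hek]; positivity
  intro c hc
  -- the derivative row at level `k`
  have hderiv := (norm_iter_sub_iter_sub_iterLin_le_uniform Q hQ0 hQs hL U' U hδ hρ0 hU hρ k hmδ hm hN k le_rfl c).2
  -- names
  set Φ : Matrix n n ℂ := ((Averaging.iter (fun i => blockAvg (P := P) (j := i) (expMeanLogSU (n := n))) k U c : Matrix.specialUnitaryGroup n ℂ) : Matrix n n ℂ) with hΦ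
  set Φ' : Matrix n n ℂ := ((Averaging.iter (fun i => blockAvg (P := P) (j := i) (expMeanLogSU (n := n))) k U' c : Matrix.specialUnitaryGroup n ℂ) : Matrix n n ℂ) with hΦ'
  set Vc : Matrix n n ℂ := ((V c : Matrix.specialUnitaryGroup n ℂ) : Matrix n n ℂ) with hVc
  set QZ : Matrix n n ℂ := Q k (fun b => ((U' b : Matrix.specialUnitaryGroup n ℂ) : Matrix n n ℂ) - ((U b : Matrix.specialUnitaryGroup n ℂ) : Matrix n n ℂ)) c with hQZ
  -- `Φ' = V − (ψ₊ − ψ₋) + R`, `‖R‖ ≤ τ + e_k`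
  set R : Matrix n n ℂ := Φ' - (Vc - (ψ c.tgt - ψ c.src)) with hR
  have hRn : ‖R‖ ≤ τ + ek := by
    have e : R = (Φ' - Φ - QZ) + (QZ - ((Vc - Φ) - (ψ c.tgt - ψ c.src))) := by rw [hR]; abel
    rw [e]
    refine (norm_add_le _ _).trans ?_
    have h1 : ‖Φ' - Φ - QZ‖ ≤ ek := hderiv
    have h2 := hT c hc
    linarith
  have hΦ'eq : Φ' = Vc - (ψ c.tgt - ψ c.src) + R := by rw [hR]; abel
  -- the gauge-rotated average at `c`
  have hgauge : ((Averaging.iter (fun i => blockAvg (P := P) (j := i) (expMeanLogSU (n := n))) k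
        (GaugeField.gaugeAct (fun x : Site P 0 => φ (iterBlockOf k x)) U') c : Matrix.specialUnitaryGroup n ℂ) : Matrix n n ℂ) =
      ((φ c.src : Matrix.specialUnitaryGroup n ℂ) : Matrix n n ℂ) * Φ' * star ((φ c.tgt : Matrix.specialUnitaryGroup n ℂ) : Matrix n n ℂ) := by
    rw [iter_gaugeAct_blockConst _ hk φ U']
    show (((φ c.src * Averaging.iter (fun i => blockAvg (P := P) (j := i) (expMeanLogSU (n := n))) k U' c * (φ c.tgt)⁻¹ :
        Matrix.specialUnitaryGroup n ℂ)) : Matrix n n ℂ) = _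
    rw [Submonoid.coe_mul, Submonoid.coe_mul]
    rfl
  rw [hgauge, hΦ'eq]
  -- the matrix inequality
  have hVn : ‖Vc‖ ≤ 1 := (CStarRing.norm_of_mem_unitary (Matrix.mem_specialUnitaryGroup_iff.1 (V c).2).1).le
  exact norm_sub_conj_update_le Vc _ _ (ψ c.src) (ψ c.tgt) R hεV hp hp₂ (add_nonneg hτ hek0) hVn (hV1 c hc) (hψ _) (hψ _) (hφ _) (hφs _) hRn

end Step

end Summit.QuantumFields.YangMills.Theorems.FLContraction

end
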